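import Summits.HodgeConjecture.HodgeConjecture.Theorems.WeilTypeLadderTargetTransfer
import Literature.AlgebraicGeometry.HodgeTheory.FermatHodgeConjectureProducts
import Mathlib.RingTheory.Polynomial.Cyclotomic.Roots
import Mathlib.RingTheory.Polynomial.Eisenstein.Basic
import Mathlib.Analysis.SpecialFunctions.Complex.Circle
import Mathlib.Tactic.ComputeDegree
import HarnessLib

/-!
# WeilTypeLadder · R3 (`WeilClassesCMField`) for the SEXTIC CM subfield `K′ = ℚ(ζ₁₉)^{C₃}` of `ℚ(ζ₁₉)` (`[K′:ℚ] = 6`, `[E:K′] = 3`):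
# minimal polynomial `T⁶ + 19T⁴ + 38T² + 19` of `θ = η − η̄` (`η = ζ + ζ⁷ + ζ¹¹`), the rung's eight arithmetic hypotheses DISCHARGED
# (Eisenstein at `19`; purely imaginary roots via the real-rootedness of the cubic `u³ + 19u² + 38u + 19`, intermediate values;
# `Q = −T`; `P(φ) = 0 ⇐ Φ₁₉(s) = 0`), the transfer over a Fermat TRIPLE `(Xʰ₁₉ ⊗ Xʰ₁₉) ⊗ Xʰ₁₉`

b2b cell `hweil` (packet `run/shared/lean/b2b/hodge-weil/`, report `b2b-hweil-pv3-g43/CM-SUBFIELD-TRANSFER.md` §3.3 row `(19, C₃)`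
and ADDENDUM A). The first R3 placement of the chair for a CM field of degree SIX. `E = ℚ(ζ₁₉)`, `U ≅ ℤ/18`, `H′ = C₃ = {1, 7, 11}`,
`K′ = E^{H′}` (CM, `K′⁺` the real cubic subfield), `s = 3`: PROPOSITION CYC′ transfers the `K′`-Weil classes to `(Xʰ₁₉)³`
(`hodgeClasses_algebraic_fermatProduct₃`, `19` prime). Generator: `η = ζ + ζ⁷ + ζ¹¹`, `η̄ = ζ⁸ + ζ¹² + ζ¹⁸`, `θ := η − η̄`
(`θ̄ = −θ`), minimal polynomial **`P = T⁶ + 19T⁴ + 38T² + 19`** (Eisenstein at `19`); on `B` with `Φ₁₉(s) = 0`: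
**`φ := s + s⁷ + s¹¹ − s⁸ − s¹² − s¹⁸`**, `P(φ) = 0` by REDUCTION modulo `Φ₁₉(T)` in three steps of degree `≤ 36` (`φ² ≡ r₂`, `r₂² ≡ r₄`,
`r₂r₄ ≡ r₆`, `r₆ + 19r₄ + 38r₂ + 19 = 0`; §1).
Dimensions: `dim B = 9h`, `h = 2n`, classes `weilClassesField B φ P (6n) ⊂ H^{6n}(B)`, `e·(2m) = 6·6n = 2·dim B`.

What is PROVED here (kernel): (§1) `P` monic of degree `6`, irreducible over `ℚ`; for a complex root `ρ`, `ρ²` is one of the three REAL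
roots of `g(u) = u³ + 19u² + 38u + 19` (located in `[−17,−3]`, `[−2,−1]`, `[−1,0]` by the intermediate value theorem; a quadratic
vanishing at three distinct points is zero), hence `ρ̄² = ρ²`, `ρ̄ ≠ ρ` (`r⁶ + 19r⁴ + 38r² + 19 > 0`), `ρ̄ = −ρ`; `Φ₁₉ = Σ_{i<19} Tⁱ`;
the reductions; `P(φ) = 0`. (§2) the R3 body over `(X₁ ⊗ X₂) ⊗ X₃`, `Xᵢ = X^{2n}₁₉`, from the two refereed named facts; from the rung
(HONEST SPECIALISATION at `(B, φ, P, 6, 3n)`, all eight hypotheses discharged); ON-PATH.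

What is NOT in the kernel: the datum (PROPOSITION CYC′) and `K′`-Weil-ness (THEOREM W′). Census (report §3.3/§7): no non-`E`-Weil
family at `N = 4`; at `N = 6` (`n = 2`, abelian `36`-folds, classes in `H¹²`) the `K′`-Weil NON-`E`-Weil families are
`(1,1,3,8,8,17)`, `(1,1,6,8,10,12)`, `(1,2,5,8,9,13)` (all MOVING).

HONEST LABEL: three-parameter sub-families, never the general member; 0 unconditional rungs above the floor; conditional on
[Shioda 1979 Thm. 2] + [Fulton 1998 Cor. 19.2 (b)] (refereed) and on the datum; Markman-free; the standing `weilClassesField`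
identification flag applies. No `sorry`, no new definition, no new named fact.
-/

noncomputable section

-- every declaration of this problem lives in `Summit.HodgeConjecture.HodgeConjecture.…` (summit = sub-problem)
set_option linter.dupNamespace false

open CategoryTheory MonoidalCategory Polynomial
open Literature.AlgebraicGeometry Literature.AlgebraicGeometry.Motives
open Literature.AlgebraicGeometry.HodgeTheory
open Literature.AlgebraicTopology.SingularHomology

namespace Summit.HodgeConjecture.HodgeConjecture.WeilTypeLadder

/-! ### §1 The sextic `T⁶ + 19T⁴ + 38T² + 19`, the cubic `u³ + 19u² + 38u + 19`, and `Φ₁₉` -/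

section Sextic

/-- `T⁶ + 19T⁴ + 38T² + 19 ∈ ℤ[T]` is monic. [folklore] -/
theorem sexticNineteen_monic : (X ^ 6 + 19 * X ^ 4 + 38 * X ^ 2 + 19 : Polynomial ℤ).Monic := by
  monicity!

/-- `T⁶ + 19T⁴ + 38T² + 19` has degree `6`. [folklore] -/
theorem sexticNineteen_natDegree : (X ^ 6 + 19 * X ^ 4 + 38 * X ^ 2 + 19 : Polynomial ℤ).natDegree = 6 := by
  compute_degree!

/-- The coefficients of `T⁶ + 19T⁴ + 38T² + 19` below the top one are divisible by `19`. [folklore] -/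
theorem sexticNineteen_coeff_mem {n : ℕ} (hn : n < 6) :
    (X ^ 6 + 19 * X ^ 4 + 38 * X ^ 2 + 19 : Polynomial ℤ).coeff n ∈ Ideal.span {(19 : ℤ)} := by
  rw [Ideal.mem_span_singleton]
  interval_cases n <;> simp [coeff_X_pow, coeff_ofNat_mul]

/-- `T⁶ + 19T⁴ + 38T² + 19` is Eisenstein at `(19)`. [folklore] -/
theorem sexticNineteen_isEisensteinAt :
    (X ^ 6 + 19 * X ^ 4 + 38 * X ^ 2 + 19 : Polynomial ℤ).IsEisensteinAt (Ideal.span {(19 : ℤ)}) where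
  leading := by
    rw [Polynomial.Monic.leadingCoeff sexticNineteen_monic, Ideal.mem_span_singleton]; norm_num
  mem := fun {n} hn => sexticNineteen_coeff_mem (by rwa [sexticNineteen_natDegree] at hn)
  notMem := by
    rw [Ideal.span_singleton_pow, Ideal.mem_span_singleton]
    simp [coeff_X_pow, coeff_ofNat_mul]

/-- `T⁶ + 19T⁴ + 38T² + 19` is irreducible over `ℚ` (Eisenstein at `19` over `ℤ`, then Gauss's lemma). [folklore] -/
theorem sexticNineteen_irreducible :
    Irreducible ((X ^ 6 + 19 * X ^ 4 + 38 * X ^ 2 + 19 : Polynomial ℤ).map (Int.castRingHom ℚ)) := by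
  have hprime : (Ideal.span {(19 : ℤ)}).IsPrime :=
    (Ideal.span_singleton_prime (by norm_num)).mpr (Nat.prime_iff_prime_int.mp (by norm_num))
  have hZ : Irreducible (X ^ 6 + 19 * X ^ 4 + 38 * X ^ 2 + 19 : Polynomial ℤ) :=
    sexticNineteen_isEisensteinAt.irreducible hprime sexticNineteen_monic.isPrimitive
      (by rw [sexticNineteen_natDegree]; norm_num)
  have := (Polynomial.IsPrimitive.irreducible_iff_irreducible_map_fraction_map (K := ℚ)
    sexticNineteen_monic.isPrimitive).1 hZ
  rwa [← algebraMap_int_eq]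

/-- Evaluation of `T⁶ + 19T⁴ + 38T² + 19` in any ring. -/
theorem eval₂_sexticNineteen {R : Type*} [Ring R] (x : R) :
    Polynomial.eval₂ (Int.castRingHom R) x (X ^ 6 + 19 * X ^ 4 + 38 * X ^ 2 + 19 : Polynomial ℤ) =
      x ^ 6 + 19 * x ^ 4 + 38 * x ^ 2 + 19 := by
  rw [← algebraMap_int_eq, ← Polynomial.aeval_def]
  simp only [map_add, map_mul, map_pow, Polynomial.aeval_X, map_ofNat]

/-- The cubic `g(u) = u³ + 19u² + 38u + 19` has three REAL roots `t₁ ≤ −3 < t₂ < −1 < t₃` (intermediate values on `[−17,−3]`,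
`[−2,−1]`, `[−1,0]`: `g(−17) = −49`, `g(−3) = 49`, `g(−2) = 11`, `g(−1) = −1`, `g(0) = 19`). [folklore] -/
theorem exists_three_roots_cubicNineteen :
    ∃ t₁ t₂ t₃ : ℝ, t₁ ^ 3 + 19 * t₁ ^ 2 + 38 * t₁ + 19 = 0 ∧ t₂ ^ 3 + 19 * t₂ ^ 2 + 38 * t₂ + 19 = 0 ∧
      t₃ ^ 3 + 19 * t₃ ^ 2 + 38 * t₃ + 19 = 0 ∧ t₁ < t₂ ∧ t₂ < t₃ ∧ t₁ < t₃ := by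
  let g : ℝ → ℝ := fun u => u ^ 3 + 19 * u ^ 2 + 38 * u + 19
  have hg : Continuous g := by fun_prop
  have h1 : (0 : ℝ) ∈ Set.Icc (g (-17)) (g (-3)) := by simp only [g, Set.mem_Icc]; norm_num
  have h2 : (0 : ℝ) ∈ Set.Icc (g (-1)) (g (-2)) := by simp only [g, Set.mem_Icc]; norm_num
  have h3 : (0 : ℝ) ∈ Set.Icc (g (-1)) (g 0) := by simp only [g, Set.mem_Icc]; norm_num
  obtain ⟨t₁, ht₁, hgt₁⟩ := intermediate_value_Icc (by norm_num : (-17 : ℝ) ≤ -3) hg.continuousOn h1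
  obtain ⟨t₂, ht₂, hgt₂⟩ := intermediate_value_Icc' (by norm_num : (-2 : ℝ) ≤ -1) hg.continuousOn h2
  obtain ⟨t₃, ht₃, hgt₃⟩ := intermediate_value_Icc (by norm_num : (-1 : ℝ) ≤ 0) hg.continuousOn h3
  simp only [g] at hgt₁ hgt₂ hgt₃
  rw [Set.mem_Icc] at ht₁ ht₂ ht₃
  have h2ne : t₂ ≠ -1 := by rintro rfl; norm_num at hgt₂
  have h3ne : t₃ ≠ -1 := by rintro rfl; norm_num at hgt₃
  refine ⟨t₁, t₂, t₃, hgt₁, hgt₂, hgt₃, by linarith [ht₁.2, ht₂.1], ?_, ?_⟩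
  · exact lt_of_lt_of_le (lt_of_le_of_ne ht₂.2 h2ne) (ht₃.1)
  · linarith [ht₁.2, ht₃.1]

/-- For a complex root `ρ` of `T⁶ + 19T⁴ + 38T² + 19`, `ρ²` is a (real) root of the cubic: `ρ̄² = ρ²`. [folklore] -/
theorem conj_sq_eq_sq_of_sexticNineteen {ρ : ℂ} (hρ : ρ ^ 6 + 19 * ρ ^ 4 + 38 * ρ ^ 2 + 19 = 0) :
    starRingEnd ℂ (ρ ^ 2) = ρ ^ 2 := by
  obtain ⟨t₁, t₂, t₃, h₁, h₂, h₃, h12, h23, h13⟩ := exists_three_roots_cubicNineteen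
  -- the quadratic `A u² + B u + C := g(u) − (u − t₁)(u − t₂)(u − t₃)` vanishes at the three distinct roots, hence is zero
  set A : ℝ := 19 + (t₁ + t₂ + t₃) with hA
  set Bq : ℝ := 38 - (t₁ * t₂ + t₁ * t₃ + t₂ * t₃) with hB
  set C : ℝ := 19 + t₁ * t₂ * t₃ with hC
  have q₁ : A * t₁ ^ 2 + Bq * t₁ + C = 0 := by rw [hA, hB, hC]; linear_combination h₁
  have q₂ : A * t₂ ^ 2 + Bq * t₂ + C = 0 := by rw [hA, hB, hC]; linear_combination h₂
  have q₃ : A * t₃ ^ 2 + Bq * t₃ + C = 0 := by rw [hA, hB, hC]; linear_combination h₃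
  have d12 : A * (t₁ + t₂) + Bq = 0 := by
    have : (t₁ - t₂) * (A * (t₁ + t₂) + Bq) = 0 := by linear_combination q₁ - q₂
    exact (mul_eq_zero.1 this).resolve_left (sub_ne_zero.2 (ne_of_lt h12))
  have d13 : A * (t₁ + t₃) + Bq = 0 := by
    have : (t₁ - t₃) * (A * (t₁ + t₃) + Bq) = 0 := by linear_combination q₁ - q₃
    exact (mul_eq_zero.1 this).resolve_left (sub_ne_zero.2 (ne_of_lt h13))
  have hA0 : A = 0 := by
    have : A * (t₂ - t₃) = 0 := by linear_combination d12 - d13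
    exact (mul_eq_zero.1 this).resolve_right (sub_ne_zero.2 (ne_of_lt h23))
  have hB0 : Bq = 0 := by rw [hA0] at d12; linarith
  have hC0 : C = 0 := by rw [hA0, hB0] at q₁; linarith
  -- over `ℂ`: `ρ²` is a root of the cubic, which factors as `(u − t₁)(u − t₂)(u − t₃)`
  have hw : (ρ ^ 2) ^ 3 + 19 * (ρ ^ 2) ^ 2 + 38 * ρ ^ 2 + 19 = 0 := by linear_combination hρ
  have hfac : (ρ ^ 2 - t₁) * (ρ ^ 2 - t₂) * (ρ ^ 2 - t₃) = 0 := by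
    have eA : ((19 + (t₁ + t₂ + t₃) : ℝ) : ℂ) = 0 := by rw [← hA, hA0]; simp
    have eB : ((38 - (t₁ * t₂ + t₁ * t₃ + t₂ * t₃) : ℝ) : ℂ) = 0 := by rw [← hB, hB0]; simp
    have eC : ((19 + t₁ * t₂ * t₃ : ℝ) : ℂ) = 0 := by rw [← hC, hC0]; simp
    push_cast at eA eB eC
    linear_combination hw - (ρ ^ 2) ^ 2 * eA - ρ ^ 2 * eB - eC
  rcases mul_eq_zero.1 hfac with h | h
  · rcases mul_eq_zero.1 h with h' | h'
    · rw [sub_eq_zero.1 h', Complex.conj_ofReal]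
    · rw [sub_eq_zero.1 h', Complex.conj_ofReal]
  · rw [sub_eq_zero.1 h, Complex.conj_ofReal]

/-- The complex roots of `T⁶ + 19T⁴ + 38T² + 19` are NON-REAL: the rung's "no real root". [folklore] -/
theorem conj_ne_self_of_sexticNineteen {ρ : ℂ}
    (hρ : Polynomial.eval₂ (Int.castRingHom ℂ) ρ (X ^ 6 + 19 * X ^ 4 + 38 * X ^ 2 + 19 : Polynomial ℤ) = 0) :
    starRingEnd ℂ ρ ≠ ρ := by
  rw [eval₂_sexticNineteen] at hρ
  intro hc
  have hre : ((ρ.re : ℝ) : ℂ) = ρ := Complex.conj_eq_iff_re.mp hc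
  have hr : ((ρ.re ^ 6 + 19 * ρ.re ^ 4 + 38 * ρ.re ^ 2 + 19 : ℝ) : ℂ) = 0 := by push_cast; rw [hre]; exact hρ
  have hr' : ρ.re ^ 6 + 19 * ρ.re ^ 4 + 38 * ρ.re ^ 2 + 19 = 0 := by exact_mod_cast hr
  nlinarith [sq_nonneg ρ.re, sq_nonneg (ρ.re ^ 2), sq_nonneg (ρ.re ^ 3)]

/-- `Q = −T` carries every complex root of `T⁶ + 19T⁴ + 38T² + 19` to its conjugate: the rung's "CM involution is a polynomial". [folklore] -/
theorem exists_conjPolynomial_sexticNineteen :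
    ∃ Q : Polynomial ℚ, ∀ ρ : ℂ, Polynomial.eval₂ (Int.castRingHom ℂ) ρ (X ^ 6 + 19 * X ^ 4 + 38 * X ^ 2 + 19 : Polynomial ℤ) = 0 →
      Polynomial.eval₂ (algebraMap ℚ ℂ) ρ Q = starRingEnd ℂ ρ := by
  refine ⟨-Polynomial.X, fun ρ hρ => ?_⟩
  have hne := conj_ne_self_of_sexticNineteen hρ
  rw [eval₂_sexticNineteen] at hρ
  rw [Polynomial.eval₂_neg, Polynomial.eval₂_X]
  have hsq : (starRingEnd ℂ ρ) ^ 2 = ρ ^ 2 := by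
    rw [← map_pow]; exact conj_sq_eq_sq_of_sexticNineteen hρ
  rcases sq_eq_sq_iff_eq_or_eq_neg.1 hsq with h | h
  · exact absurd h hne
  · exact h.symm

/-- `Φ₁₉ = 1 + T + ⋯ + T¹⁸` in `ℤ[T]`. [folklore] -/
theorem cyclotomic_nineteen_eq : Polynomial.cyclotomic 19 ℤ =
    1 + X + X ^ 2 + X ^ 3 + X ^ 4 + X ^ 5 + X ^ 6 + X ^ 7 + X ^ 8 + X ^ 9 + X ^ 10 + X ^ 11 + X ^ 12 + X ^ 13 + X ^ 14 + X ^ 15 + X ^ 16 + X ^ 17 + X ^ 18 := by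
  haveI : Fact (Nat.Prime 19) := ⟨by norm_num⟩
  rw [Polynomial.cyclotomic_prime]
  simp only [Finset.sum_range_succ, Finset.sum_range_zero, zero_add, pow_zero, pow_one]

/-- Reduction of `φ(T)²` modulo `Φ₁₉`: `φ(T)² = Φ₁₉(T)·q₂(T) + r₂(T)`, `deg r₂ ≤ 17` (integer long division). [folklore] -/
theorem sexticNineteen_sq_reduce :
    ((X + X ^ 7 + X ^ 11 - X ^ 8 - X ^ 12 - X ^ 18) ^ 2 : Polynomial ℤ) =
      (1 + X + X ^ 2 + X ^ 3 + X ^ 4 + X ^ 5 + X ^ 6 + X ^ 7 + X ^ 8 + X ^ 9 + X ^ 10 + X ^ 11 + X ^ 12 + X ^ 13 + X ^ 14 + X ^ 15 + X ^ 16 + X ^ 17 + X ^ 18) *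
        (8 - 8 * X + 2 * X ^ 2 - X ^ 3 + 3 * X ^ 4 - 3 * X ^ 5 + 3 * X ^ 6 - 4 * X ^ 7 + 2 * X ^ 8 + 2 * X ^ 10 - 4 * X ^ 11 + 2 * X ^ 12 - X ^ 17 + X ^ 18) +
      (-8 - X ^ 2 - X ^ 3 - 4 * X ^ 4 - X ^ 5 - 4 * X ^ 6 - 4 * X ^ 9 - 4 * X ^ 10 - 4 * X ^ 13 - X ^ 14 - 4 * X ^ 15 - X ^ 16 - X ^ 17) := by
  ring

/-- `r₂² = Φ₁₉·q₄ + r₄`, `deg r₄ ≤ 17`. [folklore] -/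
theorem sexticNineteen_r2_sq_reduce :
    ((-8 - X ^ 2 - X ^ 3 - 4 * X ^ 4 - X ^ 5 - 4 * X ^ 6 - 4 * X ^ 9 - 4 * X ^ 10 - 4 * X ^ 13 - X ^ 14 - 4 * X ^ 15 - X ^ 16 - X ^ 17) ^ 2 : Polynomial ℤ) =
      (1 + X + X ^ 2 + X ^ 3 + X ^ 4 + X ^ 5 + X ^ 6 + X ^ 7 + X ^ 8 + X ^ 9 + X ^ 10 + X ^ 11 + X ^ 12 + X ^ 13 + X ^ 14 + X ^ 15 + X ^ 16 + X ^ 17 + X ^ 18) *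
        (-60 + 60 * X - 6 * X ^ 4 + 8 * X ^ 5 + 8 * X ^ 7 + 16 * X ^ 8 - 17 * X ^ 9 + 17 * X ^ 10 - 10 * X ^ 11 + 16 * X ^ 12 + X ^ 13 + 7 * X ^ 14 + X ^ 15 + X ^ 16) +
      (124 + 16 * X ^ 2 + 16 * X ^ 3 + 71 * X ^ 4 + 16 * X ^ 5 + 71 * X ^ 6 + 71 * X ^ 9 + 71 * X ^ 10 + 71 * X ^ 13 + 16 * X ^ 14 + 71 * X ^ 15 + 16 * X ^ 16 + 16 * X ^ 17) := by
  ring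

set_option maxHeartbeats 400000 in
/-- `r₂·r₄ = Φ₁₉·q₅ + r₆`, `deg r₆ ≤ 17`. [folklore] -/
theorem sexticNineteen_r2_r4_reduce :
    ((-8 - X ^ 2 - X ^ 3 - 4 * X ^ 4 - X ^ 5 - 4 * X ^ 6 - 4 * X ^ 9 - 4 * X ^ 10 - 4 * X ^ 13 - X ^ 14 - 4 * X ^ 15 - X ^ 16 - X ^ 17) *
        (124 + 16 * X ^ 2 + 16 * X ^ 3 + 71 * X ^ 4 + 16 * X ^ 5 + 71 * X ^ 6 + 71 * X ^ 9 + 71 * X ^ 10 + 71 * X ^ 13 + 16 * X ^ 14 + 71 * X ^ 15 + 16 * X ^ 16 + 16 * X ^ 17) : Polynomial ℤ) =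
      (1 + X + X ^ 2 + X ^ 3 + X ^ 4 + X ^ 5 + X ^ 6 + X ^ 7 + X ^ 8 + X ^ 9 + X ^ 10 + X ^ 11 + X ^ 12 + X ^ 13 + X ^ 14 + X ^ 15 + X ^ 16 + X ^ 17 + X ^ 18) *
        (1079 - 1079 * X + 14 * X ^ 2 + 103 * X ^ 4 - 135 * X ^ 5 - 149 * X ^ 7 - 284 * X ^ 8 + 314 * X ^ 9 - 314 * X ^ 10 + 181 * X ^ 11 - 284 * X ^ 12 - 16 * X ^ 13 - 119 * X ^ 14 - 16 * X ^ 15 - 16 * X ^ 16) +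
      (-2071 - 266 * X ^ 2 - 266 * X ^ 3 - 1197 * X ^ 4 - 266 * X ^ 5 - 1197 * X ^ 6 - 1197 * X ^ 9 - 1197 * X ^ 10 - 1197 * X ^ 13 - 266 * X ^ 14 - 1197 * X ^ 15 - 266 * X ^ 16 - 266 * X ^ 17) := by
  ring

/-- The reduced form of `P(φ(T))` vanishes identically: `r₆ + 19·r₄ + 38·r₂ + 19 = 0` (a polynomial of degree `≤ 17` divisible by
`Φ₁₉` is zero). [folklore] -/
theorem sexticNineteen_reduced_eq_zero :
    ((-2071 - 266 * X ^ 2 - 266 * X ^ 3 - 1197 * X ^ 4 - 266 * X ^ 5 - 1197 * X ^ 6 - 1197 * X ^ 9 - 1197 * X ^ 10 - 1197 * X ^ 13 - 266 * X ^ 14 - 1197 * X ^ 15 - 266 * X ^ 16 - 266 * X ^ 17) +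
        19 * (124 + 16 * X ^ 2 + 16 * X ^ 3 + 71 * X ^ 4 + 16 * X ^ 5 + 71 * X ^ 6 + 71 * X ^ 9 + 71 * X ^ 10 + 71 * X ^ 13 + 16 * X ^ 14 + 71 * X ^ 15 + 16 * X ^ 16 + 16 * X ^ 17) +
        38 * (-8 - X ^ 2 - X ^ 3 - 4 * X ^ 4 - X ^ 5 - 4 * X ^ 6 - 4 * X ^ 9 - 4 * X ^ 10 - 4 * X ^ 13 - X ^ 14 - 4 * X ^ 15 - X ^ 16 - X ^ 17) + 19 : Polynomial ℤ) = 0 := by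
  ring

/-- `Φ₁₉(s) = 0 ⟹ P(s + s⁷ + s¹¹ − s⁸ − s¹² − s¹⁸) = 0` in any ring, `P = T⁶ + 19T⁴ + 38T² + 19`: with `y = φ(s)` one has
`y² = r₂(s)`, `y⁴ = r₂(s)² = r₄(s)`, `y⁶ = r₂(s)·r₄(s) = r₆(s)` (`Φ₁₉(s) = 0`), and `r₆ + 19r₄ + 38r₂ + 19 = 0`. [folklore] -/
theorem eval₂_sexticNineteen_periodDiff {R : Type*} [Ring R] (s : R)
    (hs : Polynomial.eval₂ (Int.castRingHom R) s (Polynomial.cyclotomic 19 ℤ) = 0) :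
    Polynomial.eval₂ (Int.castRingHom R) (s + s ^ 7 + s ^ 11 - s ^ 8 - s ^ 12 - s ^ 18)
      (X ^ 6 + 19 * X ^ 4 + 38 * X ^ 2 + 19 : Polynomial ℤ) = 0 := by
  rw [cyclotomic_nineteen_eq, ← algebraMap_int_eq, ← Polynomial.aeval_def] at hs
  rw [eval₂_sexticNineteen]
  have hy : (s + s ^ 7 + s ^ 11 - s ^ 8 - s ^ 12 - s ^ 18 : R) = Polynomial.aeval s ((X + X ^ 7 + X ^ 11 - X ^ 8 - X ^ 12 - X ^ 18) : Polynomial ℤ) := by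
    simp only [map_add, map_sub, map_pow, Polynomial.aeval_X]
  have hy2 : (s + s ^ 7 + s ^ 11 - s ^ 8 - s ^ 12 - s ^ 18 : R) ^ 2 =
      Polynomial.aeval s ((-8 - X ^ 2 - X ^ 3 - 4 * X ^ 4 - X ^ 5 - 4 * X ^ 6 - 4 * X ^ 9 - 4 * X ^ 10 - 4 * X ^ 13 - X ^ 14 - 4 * X ^ 15 - X ^ 16 - X ^ 17) : Polynomial ℤ) := by
    rw [hy, ← map_pow, sexticNineteen_sq_reduce, map_add, map_mul, hs, zero_mul, zero_add]
  have hy4 : (s + s ^ 7 + s ^ 11 - s ^ 8 - s ^ 12 - s ^ 18 : R) ^ 4 =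
      Polynomial.aeval s ((124 + 16 * X ^ 2 + 16 * X ^ 3 + 71 * X ^ 4 + 16 * X ^ 5 + 71 * X ^ 6 + 71 * X ^ 9 + 71 * X ^ 10 + 71 * X ^ 13 + 16 * X ^ 14 + 71 * X ^ 15 + 16 * X ^ 16 + 16 * X ^ 17) : Polynomial ℤ) := by
    rw [show (4 : ℕ) = 2 * 2 from rfl, pow_mul, hy2, ← map_pow, sexticNineteen_r2_sq_reduce, map_add, map_mul, hs,
      zero_mul, zero_add]
  have hy6 : (s + s ^ 7 + s ^ 11 - s ^ 8 - s ^ 12 - s ^ 18 : R) ^ 6 =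
      Polynomial.aeval s ((-2071 - 266 * X ^ 2 - 266 * X ^ 3 - 1197 * X ^ 4 - 266 * X ^ 5 - 1197 * X ^ 6 - 1197 * X ^ 9 - 1197 * X ^ 10 - 1197 * X ^ 13 - 266 * X ^ 14 - 1197 * X ^ 15 - 266 * X ^ 16 - 266 * X ^ 17) : Polynomial ℤ) := by
    rw [show (6 : ℕ) = 2 + 4 from rfl, pow_add, hy2, hy4, ← map_mul, sexticNineteen_r2_r4_reduce, map_add, map_mul, hs,
      zero_mul, zero_add]
  have h19 : (19 : R) = Polynomial.aeval s (19 : Polynomial ℤ) := (map_ofNat _ _).symm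
  have h38 : (38 : R) = Polynomial.aeval s (38 : Polynomial ℤ) := (map_ofNat _ _).symm
  rw [hy2, hy4, hy6, h19, h38, ← map_mul, ← map_mul, ← map_add, ← map_add, ← map_add, sexticNineteen_reduced_eq_zero, map_zero]

end Sextic

/-! ### §2 R3 for `K′ = ℚ(ζ₁₉)^{C₃} = ℚ(φ)` (degree `6`) on the `ζ₁₉`-primitive loci over the Fermat triple `(Xʰ₁₉ ⊗ Xʰ₁₉) ⊗ Xʰ₁₉` -/

section NineteenSextic

/-- **R3 for the sextic `K′ = ℚ(ζ₁₉)^{C₃}` on the Fermat-triple-dominated `ζ₁₉`-locus, from the two named facts.** For an abelian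
variety `B` with `s : B ⟶ B`, `Φ₁₉(s) = 0`, `dim B = 18n` (`h = 2n`), and a datum (`X₁, X₂, X₃` smooth projective Fermat varieties
`X^{2n}₁₉`, `T`, `a` surjective, `b : ι → (T ⟶ (X₁ ⊗ X₂) ⊗ X₃)`), every class of `weilClassesField B φ (T⁶ + 19T⁴ + 38T² + 19) (6n)`
(`φ = s + s⁷ + s¹¹ − s⁸ − s¹² − s¹⁸`) whose pull-back lies in `⨆ᵢ (bᵢ)^*(span of the rational (3n,3n)-classes)` and which is rational
of type `(3n,3n)` is algebraic. At `n = 2`: the three families of abelian `36`-folds of the report.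
[cite: Shioda1979PJA, §2 Thm. 2 (p. 112) with the list after Thm. 1] [cite: Fulton1998, §19.2 Cor. 19.2 (b)] [cite: MoonenZarhin1998WeilClasses, §1] -/
theorem weilClassesCMField_cyclicPrymNineteen_sextic_of_facts
    (hF₃ : hodgeClasses_algebraic_fermatProduct₃) (hP : fulton1998_map_mem_algebraicClasses) :
    ∀ (B : Motives.AbelianVariety ℂ) (s : B ⟶ B) (n : ℕ),
      Polynomial.eval₂ (Int.castRingHom (CategoryTheory.End B)) (s : CategoryTheory.End B)
        (Polynomial.cyclotomic 19 ℤ) = 0 → B.dim = 18 * n →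
    ∀ (X₁ X₂ X₃ T : Motives.SchemeOver ℂ),
      IsFermatVariety (2 * n) 19 X₁ → IsSmoothProjective (2 * n) X₁ → IsFermatVariety (2 * n) 19 X₂ →
      IsSmoothProjective (2 * n) X₂ → IsFermatVariety (2 * n) 19 X₃ → IsSmoothProjective (2 * n) X₃ →
      IsSmoothProjective B.dim T →
    ∀ (a : T ⟶ B.X), AlgebraicGeometry.Surjective a.left → ∀ (ι : Type) (b : ι → (T ⟶ (X₁ ⊗ X₂) ⊗ X₃)),
      ∀ c ∈ weilClassesField B
          (CategoryTheory.End.asHom (CategoryTheory.End.of s + CategoryTheory.End.of s ^ 7 + CategoryTheory.End.of s ^ 11 -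
            CategoryTheory.End.of s ^ 8 - CategoryTheory.End.of s ^ 12 - CategoryTheory.End.of s ^ 18))
          (X ^ 6 + 19 * X ^ 4 + 38 * X ^ 2 + 19 : Polynomial ℤ) (2 * (3 * n)),
        complexBetti.map a (2 * (3 * n)) c ∈ (⨆ i, (Submodule.span ℂ
            {x : complexBetti ((X₁ ⊗ X₂) ⊗ X₃) (2 * (3 * n)) |
              IsRationalClass x ∧ IsOfHodgeType (2 * n + 2 * n + 2 * n) ((X₁ ⊗ X₂) ⊗ X₃) (2 * (3 * n)) (3 * n) (3 * n) x}).map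
              (complexBetti.map (b i) (2 * (3 * n))).hom) →
        IsRationalClass c → IsOfHodgeType B.dim B.X (2 * (3 * n)) (3 * n) (3 * n) c → c ∈ algebraicClasses B.X (3 * n) := by
  intro B s n _ _ X₁ X₂ X₃ T hF₁' hX₁ hF₂' hX₂ hF₃' hX₃ hT a ha ι b c _ hc _ _
  exact abelianVariety_mem_algebraicClasses_of_targetTransferFamily hP B ((hX₁.tensor_holds hX₂).tensor_holds hX₃)
    (span_rational_hodge_le_algebraicClasses_fermatProduct₃ hF₃ (Or.inl (by norm_num)) hF₁' hX₁ hF₂' hX₂ hF₃' hX₃ (3 * n))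
    hT a b hc

/-- **The same body from the rung R3 itself** — an HONEST SPECIALISATION at `(A, φ, P, e, m) := (B, φ, T⁶ + 19T⁴ + 38T² + 19, 6, 3n)`:
`P` monic irreducible of degree `6 > 2` (Eisenstein at `19`), `P(φ) = 0` from `Φ₁₉(s) = 0`, `6·(2·3n) = 2·dim B`, roots non-real,
`Q = −T` — every arithmetic hypothesis DISCHARGED; the datum is not used. -/
theorem weilClassesCMField_cyclicPrymNineteen_sextic_of_weilClassesCMField (hR : WeilClassesCMField) :
    ∀ (B : Motives.AbelianVariety ℂ) (s : B ⟶ B) (n : ℕ),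
      Polynomial.eval₂ (Int.castRingHom (CategoryTheory.End B)) (s : CategoryTheory.End B)
        (Polynomial.cyclotomic 19 ℤ) = 0 → B.dim = 18 * n →
    ∀ (X₁ X₂ X₃ T : Motives.SchemeOver ℂ),
      IsFermatVariety (2 * n) 19 X₁ → IsSmoothProjective (2 * n) X₁ → IsFermatVariety (2 * n) 19 X₂ →
      IsSmoothProjective (2 * n) X₂ → IsFermatVariety (2 * n) 19 X₃ → IsSmoothProjective (2 * n) X₃ →
      IsSmoothProjective B.dim T →
    ∀ (a : T ⟶ B.X), AlgebraicGeometry.Surjective a.left → ∀ (ι : Type) (b : ι → (T ⟶ (X₁ ⊗ X₂) ⊗ X₃)),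
      ∀ c ∈ weilClassesField B
          (CategoryTheory.End.asHom (CategoryTheory.End.of s + CategoryTheory.End.of s ^ 7 + CategoryTheory.End.of s ^ 11 -
            CategoryTheory.End.of s ^ 8 - CategoryTheory.End.of s ^ 12 - CategoryTheory.End.of s ^ 18))
          (X ^ 6 + 19 * X ^ 4 + 38 * X ^ 2 + 19 : Polynomial ℤ) (2 * (3 * n)),
        complexBetti.map a (2 * (3 * n)) c ∈ (⨆ i, (Submodule.span ℂ
            {x : complexBetti ((X₁ ⊗ X₂) ⊗ X₃) (2 * (3 * n)) |
              IsRationalClass x ∧ IsOfHodgeType (2 * n + 2 * n + 2 * n) ((X₁ ⊗ X₂) ⊗ X₃) (2 * (3 * n)) (3 * n) (3 * n) x}).map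
              (complexBetti.map (b i) (2 * (3 * n))).hom) →
        IsRationalClass c → IsOfHodgeType B.dim B.X (2 * (3 * n)) (3 * n) (3 * n) c → c ∈ algebraicClasses B.X (3 * n) := by
  intro B s n hs hdim _ _ _ _ _ _ _ _ _ _ _ _ _ _ _ c hcW _ hc hmm
  have hφ : Polynomial.eval₂ (Int.castRingHom (CategoryTheory.End B))
      ((CategoryTheory.End.asHom (CategoryTheory.End.of s + CategoryTheory.End.of s ^ 7 + CategoryTheory.End.of s ^ 11 -
            CategoryTheory.End.of s ^ 8 - CategoryTheory.End.of s ^ 12 - CategoryTheory.End.of s ^ 18) : B ⟶ B) :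
        CategoryTheory.End B) (X ^ 6 + 19 * X ^ 4 + 38 * X ^ 2 + 19 : Polynomial ℤ) = 0 :=
    eval₂_sexticNineteen_periodDiff (CategoryTheory.End.of s) hs
  exact hR B _ (X ^ 6 + 19 * X ^ 4 + 38 * X ^ 2 + 19 : Polynomial ℤ) 6 (3 * n) sexticNineteen_monic
    sexticNineteen_natDegree (by norm_num) sexticNineteen_irreducible hφ (by omega)
    (fun ρ hρ => conj_ne_self_of_sexticNineteen hρ) exists_conjPolynomial_sexticNineteen c hcW hc hmm

/-- **On-path lemma**: `HodgeConjecture → WeilClassesCMField →` R3 for `ℚ(ζ₁₉)^{C₃}` on the `ζ₁₉`-locus. -/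
theorem weilClassesCMField_cyclicPrymNineteen_sextic_of_hodgeConjecture (hH : _root_.HodgeConjecture) :
    ∀ (B : Motives.AbelianVariety ℂ) (s : B ⟶ B) (n : ℕ),
      Polynomial.eval₂ (Int.castRingHom (CategoryTheory.End B)) (s : CategoryTheory.End B)
        (Polynomial.cyclotomic 19 ℤ) = 0 → B.dim = 18 * n →
    ∀ (X₁ X₂ X₃ T : Motives.SchemeOver ℂ),
      IsFermatVariety (2 * n) 19 X₁ → IsSmoothProjective (2 * n) X₁ → IsFermatVariety (2 * n) 19 X₂ →
      IsSmoothProjective (2 * n) X₂ → IsFermatVariety (2 * n) 19 X₃ → IsSmoothProjective (2 * n) X₃ →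
      IsSmoothProjective B.dim T →
    ∀ (a : T ⟶ B.X), AlgebraicGeometry.Surjective a.left → ∀ (ι : Type) (b : ι → (T ⟶ (X₁ ⊗ X₂) ⊗ X₃)),
      ∀ c ∈ weilClassesField B
          (CategoryTheory.End.asHom (CategoryTheory.End.of s + CategoryTheory.End.of s ^ 7 + CategoryTheory.End.of s ^ 11 -
            CategoryTheory.End.of s ^ 8 - CategoryTheory.End.of s ^ 12 - CategoryTheory.End.of s ^ 18))
          (X ^ 6 + 19 * X ^ 4 + 38 * X ^ 2 + 19 : Polynomial ℤ) (2 * (3 * n)),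
        complexBetti.map a (2 * (3 * n)) c ∈ (⨆ i, (Submodule.span ℂ
            {x : complexBetti ((X₁ ⊗ X₂) ⊗ X₃) (2 * (3 * n)) |
              IsRationalClass x ∧ IsOfHodgeType (2 * n + 2 * n + 2 * n) ((X₁ ⊗ X₂) ⊗ X₃) (2 * (3 * n)) (3 * n) (3 * n) x}).map
              (complexBetti.map (b i) (2 * (3 * n))).hom) →
        IsRationalClass c → IsOfHodgeType B.dim B.X (2 * (3 * n)) (3 * n) (3 * n) c → c ∈ algebraicClasses B.X (3 * n) :=
  weilClassesCMField_cyclicPrymNineteen_sextic_of_weilClassesCMField (weilClassesCMField_of_hodgeConjecture hH)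

end NineteenSextic

end Summit.HodgeConjecture.HodgeConjecture.WeilTypeLadder

end
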